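import Mathlib
import HarnessLib
import Summits.Ventures.LatticeQCDFlow.Scoring.BlockCountDomination

/-!
# Counting bad blocks, the Chernoff-optimal threshold bound: under one-sided conditional bounds
# `≤ q` with `0 < q ≤ 1/2`, `P(#bad ≥ R/2) ≤ (2√(q(1−q)))^R`

HONEST FRAMING: exact (Metropolis-corrected) sampling algorithms for lattice gauge theory;
figures of merit are autocorrelation/cost numbers at stated couplings and volumes; no
continuum-physics claim.

Venture `LatticeQCDFlow` (cell pub-lqcd), topic `Scoring`; FANOUT row 8 (`s0-cpn-nemc`, GEN-17).
NEW WORK of the cell, not a published result; no definition is introduced.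
`Scoring/BlockCountDomination.lean` (GEN-15) proved the generating-function bound
`μ{S_R ≥ k} ≤ (1 − q + q a)^R / a^k` for every `a ≥ 1` under the one-sided conditional hypothesis
`hcond`, and specialised it at `a = 3`, `q ≤ 1/4` to `e^{−R/8}`.  Here the optimal `a = (1 − q)/q`
(`≥ 1` iff `q ≤ 1/2`): `μ{S_R ≥ R/2} ≤ (2√(q(1 − q)))^R = (4q(1−q))^{R/2} = e^{−R·KL(1/2 ‖ q)}`, the
Chernoff–Hoeffding rate of the Binomial(`R`, `q`) median event, valid for EVERY `q ∈ (0, 1/2]`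
(nontrivial for `q < 1/2`; at `q = 1/4` it reads `(3/4)^{R/2} = e^{−0.1438 R} ≤ e^{−R/8}`).  So the
median-of-blocks / median-of-tour-groups certificates of the row need only a per-block bound
`q < 1/2` (not `q ≤ 1/4`), at the price of the rate `(4q(1−q))^{R/2}`.  Printed counterpart NAMED
ONLY: Chernoff 1952 / Hoeffding 1963 (the relative-entropy form of the binomial tail); nothing is
cited as a fact.

## Content (`μ` a probability measure; `χ_j ∈ {0,1}` measurable; `S_R = Σ_{j<R} χ_j`; `hcond` as in
## `Scoring/BlockCountDomination.lean`; `0 < q ≤ 1/2`)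

* `sqrt_ratio_facts` — `a = (1−q)/q ≥ 1`, `1 − q + q a = 2(1−q)`, `2√(q(1−q)) · √a = 2(1−q)`;
* **`measureReal_countGe_half_le_chernoff`** — `μ{S_R ≥ R/2} ≤ (2√(q(1−q)))^R`.

NOT CLAIMED: thresholds other than `R/2`; two-sided bounds.
-/

noncomputable section

namespace Summit.Ventures.LatticeQCDFlow.Scoring

open MeasureTheory ProbabilityTheory Filter Finset
open scoped ENNReal

variable {α : Type*} [MeasurableSpace α]

section Chernoff

variable (μ : Measure α) [IsProbabilityMeasure μ] {χ : ℕ → α → ℝ}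

omit [MeasurableSpace α] in
/-- Arithmetic of the optimal parameter `a = (1 − q)/q`: `1 ≤ a`, `1 − q + q a = 2(1 − q)` and
`2√(q(1−q)) · √a = 2(1 − q)`. -/
theorem sqrt_ratio_facts {q : ℝ} (hq0 : 0 < q) (hq2 : q ≤ 1 / 2) :
    1 ≤ (1 - q) / q ∧ 1 - q + q * ((1 - q) / q) = 2 * (1 - q)
      ∧ 2 * Real.sqrt (q * (1 - q)) * Real.sqrt ((1 - q) / q) = 2 * (1 - q) := by
  have hq1 : 0 < 1 - q := by linarith
  refine ⟨?_, ?_, ?_⟩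
  · rw [le_div_iff₀ hq0]; linarith
  · field_simp
    ring
  · rw [mul_assoc, ← Real.sqrt_mul (mul_nonneg hq0.le hq1.le)]
    have h : q * (1 - q) * ((1 - q) / q) = (1 - q) ^ 2 := by field_simp
    rw [h, Real.sqrt_sq hq1.le]

/-- **THE CHERNOFF-OPTIMAL COUNT BOUND AT THRESHOLD `R/2`.**  Under `hcond` with `0 < q ≤ 1/2`:
`μ{S_R ≥ R/2} ≤ (2√(q(1−q)))^R` (`= (4q(1−q))^{R/2}`). -/
theorem measureReal_countGe_half_le_chernoff (hχm : ∀ j, Measurable (χ j))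
    (hχ : ∀ j ω, χ j ω = 0 ∨ χ j ω = 1) {q : ℝ} (hq0 : 0 < q) (hq2 : q ≤ 1 / 2)
    (hcond : ∀ (j : ℕ) (c : ℕ), ∫ ω, (if ∑ i ∈ Finset.range j, χ i ω = (c : ℝ) then (1 : ℝ) else 0)
        * χ j ω ∂μ ≤ q * μ.real {ω | ∑ i ∈ Finset.range j, χ i ω = (c : ℝ)})
    (R : ℕ) :
    μ.real {ω | (R : ℝ) / 2 ≤ ∑ i ∈ Finset.range R, χ i ω} ≤ (2 * Real.sqrt (q * (1 - q))) ^ R := by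
  obtain ⟨ha1, hM, hprod⟩ := sqrt_ratio_facts hq0 hq2
  set a : ℝ := (1 - q) / q with hadef
  have ha0 : 0 < a := one_pos.trans_le ha1
  have hq1 : 0 < 1 - q := by linarith
  -- the event `{R/2 ≤ S_R}` is `{⌈R/2⌉ ≤ S_R}` by integrality
  set k : ℕ := (R + 1) / 2 with hk
  have hRk : R ≤ 2 * k := by omega
  have hsub : {ω | (R : ℝ) / 2 ≤ ∑ i ∈ Finset.range R, χ i ω}
      ⊆ {ω | (k : ℝ) ≤ ∑ i ∈ Finset.range R, χ i ω} := by
    intro ω hω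
    obtain ⟨n, hn⟩ := exists_nat_eq_sum_zeroOne hχ ω R
    simp only [Set.mem_setOf_eq, hn] at hω ⊢
    have h2 : (R : ℝ) ≤ 2 * n := by linarith
    have h3 : R ≤ 2 * n := by exact_mod_cast h2
    have h4 : k ≤ n := by omega
    exact_mod_cast h4
  have hb := measureReal_countGe_le μ hχm hχ hq0.le (by linarith) hcond ha1 R k
  refine (measureReal_mono hsub).trans (hb.trans ?_)
  rw [hM]
  -- `(2(1−q))^R / a^k ≤ (2√(q(1−q)))^R` since `a^k ≥ (√a)^R` and `2√(q(1−q)) √a = 2(1−q)`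
  have hsa1 : 1 ≤ Real.sqrt a := by rw [← Real.sqrt_one]; exact Real.sqrt_le_sqrt ha1
  have hsa0 : 0 < Real.sqrt a := Real.sqrt_pos.2 ha0
  have hak : Real.sqrt a ^ R ≤ a ^ k := by
    calc Real.sqrt a ^ R ≤ Real.sqrt a ^ (2 * k) := pow_le_pow_right₀ hsa1 hRk
      _ = (Real.sqrt a ^ 2) ^ k := by rw [pow_mul]
      _ = a ^ k := by rw [Real.sq_sqrt ha0.le]
  have hkey : (2 * (1 - q)) ^ R = (2 * Real.sqrt (q * (1 - q))) ^ R * Real.sqrt a ^ R := by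
    rw [← mul_pow, hprod]
  rw [div_le_iff₀ (pow_pos ha0 k), hkey]
  exact mul_le_mul_of_nonneg_left hak (pow_nonneg (by positivity) R)

end Chernoff

end Summit.Ventures.LatticeQCDFlow.Scoring

end
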